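import Literature.MathematicalPhysics.QuantumFieldTheory.Balaban1983to89.B15Chi175LargeFieldFactor
import Literature.MathematicalPhysics.QuantumFieldTheory.Balaban1983to89.T4ShellMeasure
import HarnessLib

/-!
# YM-DAG node N21 (= NE7c) — THE N12 ⊗ N20 JUNCTION: the pointwise single-run shell factor of [B15] p. 193
# (in-edge N12, landed by seat n21-b as `B15Chi175LargeFieldFactor.shellBelow_mul_exp_neg_wilsonLoc_le`) INTEGRATED into
# the per-slot shell RATIO of the N21 ledgers, the relative normalisation being the NE7b-type input (in-edge N20)

Track A of `YM-PLAN.md` (cell `pub-ymgap`, HUMAN RULING D-0062), node **N21** of 28; seat `pub-ymgap-dag-n21-a`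
(KNIT-BY-NAME), companion of `BalabanUVNodesN21ShellWeightKnit` (p408928: `ShellWeightBound` ⇐ level ∕ age ledgers).

HONEST FRAMING.  NE7c (`T4IndicatorShell.ShellWeightBound`) is NOT PRINTED in [Bałaban 1983–89] and NOT PROVED here.
Kernel bookkeeping: 0 `def`, 0 `sorry`, standard axioms; every estimate-shaped input is a DISPLAYED hypothesis named
after the DAG in-edge that owes it; nothing of Bałaban's is asserted.  One finite four-torus programme at fixed `ε` — NOT
infinite volume, NOT ℝ⁴, NOT OS axioms, NOT a mass gap, NOT Clay.  COUNT-NEUTRAL.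

WHAT THE TWO IN-EDGES OWE AT THIS JUNCTION.  The age ledger of road II (`T4ShellCount.AgeLedger`, field `ratio`) and
the slot ledger of road I (`T4ShellMeasure.SlotLedger`, field `slot`) want, per slot, an INTEGRATED RELATIVE inequality
«shell piece of the slot ≤ x × the run's total weight».  Print's mechanism ([Balaban1989LargeFieldI] p. 193 *"This
condition is enough to get the exponential small factor, estimating in the usual way the Wilson action. Thus 1 − χ_{k,Λ}
is a large field function"*) is POINTWISE and ABSOLUTE: on the shell below the threshold (a same-run large-field event at
the lowered threshold) the Wilson factor is small — in the tree, n21-b's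
`B15Chi175LargeFieldFactor.shellBelow_mul_exp_neg_wilsonLoc_le`: `1[shell](u)·exp(−A(ζ, V)) ≤ exp(−w c_G⁻¹((CBM²)⁻¹ε′)²)`.
To make it RELATIVE one keeps half of the action (linearity `B16Sect1Wilson.wilsonLoc_smul`:
`e^{−A(ζ)} = e^{−A(ζ/2)}·e^{−A(ζ/2)}`), spends the other half on the small factor, and then needs the ratio
`∫ e^{−A(ζ/2)}·R ≤ C·∫ e^{−A(ζ)}·R` of the HALF-COUPLING density to the full one over the rest `R ≥ 0` of the term —
a relative-weight statement of King's (3.10)–(3.11) species, i.e. NE7b machinery (in-edge N20; NOT PRINTED as such,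
[Balaban1989LargeFieldII] (1.79)–(1.89) pp. 383–387 being its one-run survival arithmetic).  With both, the per-slot ratio
is `x = C·exp(−q/2)` — INDEPENDENT OF `K`: by name this is `T4ShellCount.LoweredThresholdSuppression`, which yields the
UNIFORM budget `T4ShellCount.ageWeight_le_of_printedShapes` and NOT the field `ShellWeightBound.summable`
(`T4ShellCount.not_summable_of_printedShapes_saturated`): the level-anchored gain of in-edge N16 (road I's anti-
concentration at relative scale `ρ_j`, or road (δ)'s threshold averaging) remains the missing factor.  This file types
the junction exactly and says so.

WHAT IS PROVED ([folklore]).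
§1 abstract junction, hypothesis-free in `ℝ≥0∞` and with integrability in `ℝ`: pointwise `s·w ≤ c·w′` [N12 shape] +
  ratio `∫ w′R ≤ C ∫ wR` [N20 shape] ⇒ `∫ s·w·R ≤ (cC)·∫ w·R` (`lintegral_shell_le_of_pointwise` (N12's half alone),
  `lintegral_shell_le_of_pointwise_of_ratio`,
  `integral_shell_le_of_pointwise_of_ratio`), and summed over a finite term class (`sum_integral_shell_le_of_ratio`:
  the `AgeLedger.ratio` ∕ `SlotLedger.slot` shape, the N20 ratio asked ONCE for the class totals).
§2 the half-weight split of the Wilson factor (`exp_neg_wilsonLoc_eq_half_mul_half`) and n21-b's factor AT HALF WEIGHT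
  with the other half carried along, BY NAME (`shellBelow_mul_exp_neg_wilsonLoc_le_half`): pointwise
  `1[shell](u)·e^{−A(ζ,V)} ≤ e^{−(w/2)c_G⁻¹((CBM²)⁻¹ε′)²}·e^{−A(ζ/2,V)}` under n21-b's binders (`hext`, `hreg`, …).
§3 the integrated junction on any measure space carrying the configuration `Φ : Ω → GaugeField P k G`, the slot's tested
  variable `u : Ω → ℝ` and the rest `R ≥ 0` of the term: `lintegral_shell_wilson_le` (absolute, half-coupling density on
  the right — N12 alone) and `lintegral_shell_wilson_le_of_ratio` (relative, given the N20 ratio).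
-/

set_option autoImplicit false

noncomputable section

open MeasureTheory Finset
open scoped ENNReal

namespace Summit.QuantumFields.YangMills.Theorems

open Literature.MathematicalPhysics.QuantumFieldTheory.Balaban1983to89
open T4IndicatorShell (shellBelow shellBelow_nonneg)
open B16Sect1Wilson (wilsonLoc wilsonLoc_smul wilsonLoc_nonneg)
open B15.PrelimIntegrations (Extension193 Chi175)
open B15Chi175LargeFieldFactor (shellBelow_mul_exp_neg_wilsonLoc_le)
open GaugeField (plaqHol)

/-! ## §1 The abstract junction: pointwise factor [N12] + normalisation ratio [N20] ⇒ integrated relative bound -/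

section Abstract

variable {X : Type*} [MeasurableSpace X] (μ : Measure X)

/-- **N12's half alone, `ℝ≥0∞` form (no measurability, no integrability).**  Pointwise `s·w ≤ c·w′` (the shell indicator
times the weight is small against the LEFTOVER weight `w′`) gives `∫ s·w·R ≤ c·∫ w′·R` for any rest `R`. [folklore] -/
theorem lintegral_shell_le_of_pointwise {s w w' R : X → ℝ≥0∞} {c : ℝ≥0∞} (hc : c ≠ ∞)
    (hpt : ∀ x, s x * w x ≤ c * w' x) :
    ∫⁻ x, s x * w x * R x ∂μ ≤ c * ∫⁻ x, w' x * R x ∂μ :=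
  calc ∫⁻ x, s x * w x * R x ∂μ ≤ ∫⁻ x, c * (w' x * R x) ∂μ :=
        lintegral_mono fun x => by
          calc s x * w x * R x ≤ c * w' x * R x := mul_le_mul' (hpt x) le_rfl
            _ = c * (w' x * R x) := mul_assoc _ _ _
    _ = c * ∫⁻ x, w' x * R x ∂μ := lintegral_const_mul' c _ hc

/-- **THE JUNCTION, `ℝ≥0∞` form (no measurability, no integrability).**  Pointwise `s·w ≤ c·w′` and the ratio
`∫ w′R ≤ C·∫ wR` of the leftover density to the full one give `∫ s·w·R ≤ (c·C)·∫ w·R`. [folklore] -/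
theorem lintegral_shell_le_of_pointwise_of_ratio {s w w' R : X → ℝ≥0∞} {c C : ℝ≥0∞} (hc : c ≠ ∞)
    (hpt : ∀ x, s x * w x ≤ c * w' x) (hratio : ∫⁻ x, w' x * R x ∂μ ≤ C * ∫⁻ x, w x * R x ∂μ) :
    ∫⁻ x, s x * w x * R x ∂μ ≤ (c * C) * ∫⁻ x, w x * R x ∂μ :=
  calc ∫⁻ x, s x * w x * R x ∂μ ≤ c * ∫⁻ x, w' x * R x ∂μ := lintegral_shell_le_of_pointwise μ hc hpt
    _ ≤ c * (C * ∫⁻ x, w x * R x ∂μ) := mul_le_mul' le_rfl hratio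
    _ = (c * C) * ∫⁻ x, w x * R x ∂μ := (mul_assoc _ _ _).symm

/-- **THE JUNCTION, real form** (the ledgers' currency): `0 ≤ s, w, R`, `0 ≤ c`, pointwise `s·w ≤ c·w′`, `w′R` integrable,
ratio `∫ w′R ≤ C·∫ wR` ⇒ `∫ s·w·R ≤ (c·C)·∫ w·R`. [folklore] -/
theorem integral_shell_le_of_pointwise_of_ratio {s w w' R : X → ℝ} {c C : ℝ} (hs : ∀ x, 0 ≤ s x) (hw : ∀ x, 0 ≤ w x)
    (hR : ∀ x, 0 ≤ R x) (hc : 0 ≤ c) (hpt : ∀ x, s x * w x ≤ c * w' x)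
    (hint : Integrable (fun x => w' x * R x) μ) (hratio : ∫ x, w' x * R x ∂μ ≤ C * ∫ x, w x * R x ∂μ) :
    ∫ x, s x * w x * R x ∂μ ≤ (c * C) * ∫ x, w x * R x ∂μ :=
  calc ∫ x, s x * w x * R x ∂μ ≤ ∫ x, c * (w' x * R x) ∂μ :=
        integral_mono_of_nonneg (ae_of_all _ fun x => mul_nonneg (mul_nonneg (hs x) (hw x)) (hR x))
          (hint.const_mul c) (ae_of_all _ fun x => by
            calc s x * w x * R x ≤ c * w' x * R x := mul_le_mul_of_nonneg_right (hpt x) (hR x)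
              _ = c * (w' x * R x) := mul_assoc _ _ _)
    _ = c * ∫ x, w' x * R x ∂μ := integral_const_mul c _
    _ ≤ c * (C * ∫ x, w x * R x ∂μ) := mul_le_mul_of_nonneg_left hratio hc
    _ = (c * C) * ∫ x, w x * R x ∂μ := (mul_assoc _ _ _).symm

/-- **Summed over a finite term class** (the shape of `T4ShellCount.AgeLedger.ratio` ∕ `T4ShellMeasure.SlotLedger.slot`):
each term `τ` has its own rest `R τ ≥ 0`; the pointwise factor is common; the N20-type ratio is asked ONCE, for the CLASS
totals `Σ_τ ∫ w′R_τ ≤ C·Σ_τ ∫ wR_τ`.  Conclusion: `Σ_τ ∫ s·w·R_τ ≤ (c·C)·Σ_τ ∫ w·R_τ`. [folklore] -/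
theorem sum_integral_shell_le_of_ratio {ι : Type*} (T : Finset ι) {s w w' : X → ℝ} {R : ι → X → ℝ} {c C : ℝ}
    (hs : ∀ x, 0 ≤ s x) (hw : ∀ x, 0 ≤ w x) (hR : ∀ τ ∈ T, ∀ x, 0 ≤ R τ x) (hc : 0 ≤ c)
    (hpt : ∀ x, s x * w x ≤ c * w' x) (hint : ∀ τ ∈ T, Integrable (fun x => w' x * R τ x) μ)
    (hratio : ∑ τ ∈ T, ∫ x, w' x * R τ x ∂μ ≤ C * ∑ τ ∈ T, ∫ x, w x * R τ x ∂μ) :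
    ∑ τ ∈ T, ∫ x, s x * w x * R τ x ∂μ ≤ (c * C) * ∑ τ ∈ T, ∫ x, w x * R τ x ∂μ := by
  have hτ : ∀ τ ∈ T, ∫ x, s x * w x * R τ x ∂μ ≤ c * ∫ x, w' x * R τ x ∂μ := fun τ hτ =>
    calc ∫ x, s x * w x * R τ x ∂μ ≤ ∫ x, c * (w' x * R τ x) ∂μ :=
          integral_mono_of_nonneg (ae_of_all _ fun x => mul_nonneg (mul_nonneg (hs x) (hw x)) (hR τ hτ x))
            ((hint τ hτ).const_mul c) (ae_of_all _ fun x => by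
              calc s x * w x * R τ x ≤ c * w' x * R τ x := mul_le_mul_of_nonneg_right (hpt x) (hR τ hτ x)
                _ = c * (w' x * R τ x) := mul_assoc _ _ _)
      _ = c * ∫ x, w' x * R τ x ∂μ := integral_const_mul c _
  calc ∑ τ ∈ T, ∫ x, s x * w x * R τ x ∂μ ≤ ∑ τ ∈ T, c * ∫ x, w' x * R τ x ∂μ := sum_le_sum hτ
    _ = c * ∑ τ ∈ T, ∫ x, w' x * R τ x ∂μ := (mul_sum _ _ _).symm
    _ ≤ c * (C * ∑ τ ∈ T, ∫ x, w x * R τ x ∂μ) := mul_le_mul_of_nonneg_left hratio hc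
    _ = (c * C) * ∑ τ ∈ T, ∫ x, w x * R τ x ∂μ := (mul_assoc _ _ _).symm

end Abstract

/-! ## §2 The half-weight split of the Wilson factor and n21-b's pointwise factor at half weight -/

section HalfWeight

variable {P : Params} {k : ℕ} {G : Type*} [GaugeGroup G]

/-- **Half-weight split**: `exp(−A(ζ, V)) = exp(−A(ζ/2, V))·exp(−A(ζ/2, V))` (`B16Sect1Wilson.wilsonLoc_smul`: the action
is linear in the plaquette weight). [folklore] -/
theorem exp_neg_wilsonLoc_eq_half_mul_half (ζ : Plaq P k → ℝ) (V : GaugeField P k G) :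
    Real.exp (-wilsonLoc ζ V) =
      Real.exp (-wilsonLoc (fun p => (1 / 2 : ℝ) * ζ p) V) * Real.exp (-wilsonLoc (fun p => (1 / 2 : ℝ) * ζ p) V) := by
  rw [← Real.exp_add, wilsonLoc_smul]
  congr 1
  ring

variable {Pl : Type*} {cG : ℝ}

/-- **n21-b's SINGLE-RUN SHELL FACTOR AT HALF WEIGHT, the other half carried along** (in-edge N12 BY NAME:
`B15Chi175LargeFieldFactor.shellBelow_mul_exp_neg_wilsonLoc_le` applied to the weight `ζ/2`, whose lower bound on the
plaquettes of `Z∩Λᶜ` is `w/2`): pointwise in the field,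
`1[2ε_kη² − Δ ≤ u < 2ε_kη²]·exp(−A(ζ, V)) ≤ exp(−(w/2)·c_G⁻¹·((C·B·M²)⁻¹ε′)²)·exp(−A(ζ/2, V))`.
CONDITIONAL on n21-b's binders (`hext`, `hreg`, `hcmp`, the slot implication `hu`); nothing of Bałaban's asserted.
[folklore] -/
theorem shellBelow_mul_exp_neg_wilsonLoc_le_half {outB : Set (PBond P k)} {outP allP : Set (Plaq P k)}
    {C M B η ε' εk δ₀ w : ℝ} (hC : 0 < C) (hM : 0 < M) (hB : 0 < B) (hε' : 0 < ε')
    (hext : Extension193 (G := G) outB outP allP C M ((C * B * M ^ 2)⁻¹ * ε'))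
    (dev : GaugeField P k G → Pl → ℝ) (S : Set Pl)
    (hreg : ∀ (W : GaugeField P k G) (δ : ℝ), 0 < δ → δ ≤ δ₀ → PlaqSmallOn allP δ W →
      ∀ p ∈ S, dev W p < B * δ * η ^ 2)
    (hδ₀ : B⁻¹ * ε' ≤ δ₀) (hcmp : ∀ g : G, dist1 g ^ 2 ≤ cG * (1 - reTr g)) (hcG : 0 < cG)
    (ζ : Plaq P k → ℝ) (hζ : ∀ p, 0 ≤ ζ p) (hw : ∀ p ∈ outP, w ≤ ζ p) {V : GaugeField P k G} {u : ℝ}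
    (hu : 2 * ε' * η ^ 2 ≤ u →
      ¬ Chi175 (fun (e : {W : GaugeField P k G // ∀ b ∈ outB, W b = V b}) (p : Pl) => dev e.1 p) S ε' η) :
    shellBelow u (2 * εk * η ^ 2) (2 * (εk - ε') * η ^ 2) * Real.exp (-wilsonLoc ζ V) ≤
      Real.exp (-(w / 2 * (cG⁻¹ * ((C * B * M ^ 2)⁻¹ * ε') ^ 2))) *
        Real.exp (-wilsonLoc (fun p => (1 / 2 : ℝ) * ζ p) V) := by
  have hhalf := shellBelow_mul_exp_neg_wilsonLoc_le (εk := εk) hC hM hB hε' hext dev S hreg hδ₀ hcmp hcG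
    (fun p => (1 / 2 : ℝ) * ζ p) (fun p => by have := hζ p; positivity)
    (fun p hp => show w / 2 ≤ 1 / 2 * ζ p by have := hw p hp; linarith) hu
  rw [exp_neg_wilsonLoc_eq_half_mul_half ζ V, ← mul_assoc]
  exact mul_le_mul_of_nonneg_right hhalf (Real.exp_pos _).le

end HalfWeight

/-! ## §3 The integrated junction for one background-mediated slot of one term -/

section Integrated

variable {P : Params} {k : ℕ} {G : Type*} [GaugeGroup G] {Pl : Type*} {cG : ℝ}
  {Ω : Type*} [MeasurableSpace Ω] (ν : Measure Ω)

/-- **N12 ALONE, INTEGRATED (absolute form).**  Along any measure `ν` on a space `Ω` carrying the configuration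
`Φ : Ω → GaugeField P k G` of the step, the slot's tested variable `u : Ω → ℝ` (with the slot implication `hu` at every
point) and the REST `R ≥ 0` of the term's density: the shell piece of the slot integrates to at most the small factor
times the HALF-COUPLING density, `∫⁻ 1[shell](u)·e^{−A(ζ,Φ)}·R dν ≤ e^{−(w/2)c_G⁻¹((CBM²)⁻¹ε′)²}·∫⁻ e^{−A(ζ/2,Φ)}·R dν`.
CONDITIONAL on n21-b's binders; nothing of Bałaban's asserted. [folklore] -/
theorem lintegral_shell_wilson_le {outB : Set (PBond P k)} {outP allP : Set (Plaq P k)}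
    {C M B η ε' εk δ₀ w : ℝ} (hC : 0 < C) (hM : 0 < M) (hB : 0 < B) (hε' : 0 < ε')
    (hext : Extension193 (G := G) outB outP allP C M ((C * B * M ^ 2)⁻¹ * ε'))
    (dev : GaugeField P k G → Pl → ℝ) (S : Set Pl)
    (hreg : ∀ (W : GaugeField P k G) (δ : ℝ), 0 < δ → δ ≤ δ₀ → PlaqSmallOn allP δ W →
      ∀ p ∈ S, dev W p < B * δ * η ^ 2)
    (hδ₀ : B⁻¹ * ε' ≤ δ₀) (hcmp : ∀ g : G, dist1 g ^ 2 ≤ cG * (1 - reTr g)) (hcG : 0 < cG)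
    (ζ : Plaq P k → ℝ) (hζ : ∀ p, 0 ≤ ζ p) (hw : ∀ p ∈ outP, w ≤ ζ p)
    (Φ : Ω → GaugeField P k G) (u : Ω → ℝ) (R : Ω → ℝ≥0∞)
    (hu : ∀ ω, 2 * ε' * η ^ 2 ≤ u ω →
      ¬ Chi175 (fun (e : {W : GaugeField P k G // ∀ b ∈ outB, W b = Φ ω b}) (p : Pl) => dev e.1 p) S ε' η) :
    ∫⁻ ω, ENNReal.ofReal (shellBelow (u ω) (2 * εk * η ^ 2) (2 * (εk - ε') * η ^ 2)) *
        ENNReal.ofReal (Real.exp (-wilsonLoc ζ (Φ ω))) * R ω ∂ν ≤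
      ENNReal.ofReal (Real.exp (-(w / 2 * (cG⁻¹ * ((C * B * M ^ 2)⁻¹ * ε') ^ 2)))) *
        ∫⁻ ω, ENNReal.ofReal (Real.exp (-wilsonLoc (fun p => (1 / 2 : ℝ) * ζ p) (Φ ω))) * R ω ∂ν :=
  lintegral_shell_le_of_pointwise ν
    (s := fun ω => ENNReal.ofReal (shellBelow (u ω) (2 * εk * η ^ 2) (2 * (εk - ε') * η ^ 2)))
    (w := fun ω => ENNReal.ofReal (Real.exp (-wilsonLoc ζ (Φ ω))))
    (w' := fun ω => ENNReal.ofReal (Real.exp (-wilsonLoc (fun p => (1 / 2 : ℝ) * ζ p) (Φ ω)))) (R := R)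
    ENNReal.ofReal_ne_top (fun ω => by
      rw [← ENNReal.ofReal_mul (shellBelow_nonneg _ _ _), ← ENNReal.ofReal_mul (Real.exp_pos _).le]
      exact ENNReal.ofReal_le_ofReal (shellBelow_mul_exp_neg_wilsonLoc_le_half hC hM hB hε' hext dev S hreg hδ₀
        hcmp hcG ζ hζ hw (hu ω)))

/-- **N12 ⊗ N20, INTEGRATED (the per-slot RATIO).**  Adding the NE7b-type normalisation ratio of the half-coupling density
to the full one over the rest of the term, `∫⁻ e^{−A(ζ/2,Φ)}·R dν ≤ C₂₀·∫⁻ e^{−A(ζ,Φ)}·R dν` (in-edge N20's species; NOT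
PRINTED as such), the slot's shell piece is RELATIVELY small:
`∫⁻ 1[shell](u)·e^{−A(ζ,Φ)}·R dν ≤ (e^{−(w/2)c_G⁻¹((CBM²)⁻¹ε′)²}·C₂₀)·∫⁻ e^{−A(ζ,Φ)}·R dν` — the integrated form of
`T4ShellCount.LoweredThresholdSuppression` for this slot, with a `K`-INDEPENDENT ratio (hence the uniform budget only:
`T4ShellCount.ageWeight_le_of_printedShapes`, and NOT `ShellWeightBound.summable`:
`T4ShellCount.not_summable_of_printedShapes_saturated`).  CONDITIONAL on every displayed binder. [folklore] -/
theorem lintegral_shell_wilson_le_of_ratio {outB : Set (PBond P k)} {outP allP : Set (Plaq P k)}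
    {C M B η ε' εk δ₀ w : ℝ} (hC : 0 < C) (hM : 0 < M) (hB : 0 < B) (hε' : 0 < ε')
    (hext : Extension193 (G := G) outB outP allP C M ((C * B * M ^ 2)⁻¹ * ε'))
    (dev : GaugeField P k G → Pl → ℝ) (S : Set Pl)
    (hreg : ∀ (W : GaugeField P k G) (δ : ℝ), 0 < δ → δ ≤ δ₀ → PlaqSmallOn allP δ W →
      ∀ p ∈ S, dev W p < B * δ * η ^ 2)
    (hδ₀ : B⁻¹ * ε' ≤ δ₀) (hcmp : ∀ g : G, dist1 g ^ 2 ≤ cG * (1 - reTr g)) (hcG : 0 < cG)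
    (ζ : Plaq P k → ℝ) (hζ : ∀ p, 0 ≤ ζ p) (hw : ∀ p ∈ outP, w ≤ ζ p)
    (Φ : Ω → GaugeField P k G) (u : Ω → ℝ) (R : Ω → ℝ≥0∞)
    (hu : ∀ ω, 2 * ε' * η ^ 2 ≤ u ω →
      ¬ Chi175 (fun (e : {W : GaugeField P k G // ∀ b ∈ outB, W b = Φ ω b}) (p : Pl) => dev e.1 p) S ε' η)
    {C₂₀ : ℝ≥0∞}
    (hratio : ∫⁻ ω, ENNReal.ofReal (Real.exp (-wilsonLoc (fun p => (1 / 2 : ℝ) * ζ p) (Φ ω))) * R ω ∂ν ≤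
      C₂₀ * ∫⁻ ω, ENNReal.ofReal (Real.exp (-wilsonLoc ζ (Φ ω))) * R ω ∂ν) :
    ∫⁻ ω, ENNReal.ofReal (shellBelow (u ω) (2 * εk * η ^ 2) (2 * (εk - ε') * η ^ 2)) *
        ENNReal.ofReal (Real.exp (-wilsonLoc ζ (Φ ω))) * R ω ∂ν ≤
      (ENNReal.ofReal (Real.exp (-(w / 2 * (cG⁻¹ * ((C * B * M ^ 2)⁻¹ * ε') ^ 2)))) * C₂₀) *
        ∫⁻ ω, ENNReal.ofReal (Real.exp (-wilsonLoc ζ (Φ ω))) * R ω ∂ν :=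
  lintegral_shell_le_of_pointwise_of_ratio ν
    (s := fun ω => ENNReal.ofReal (shellBelow (u ω) (2 * εk * η ^ 2) (2 * (εk - ε') * η ^ 2)))
    (w := fun ω => ENNReal.ofReal (Real.exp (-wilsonLoc ζ (Φ ω))))
    (w' := fun ω => ENNReal.ofReal (Real.exp (-wilsonLoc (fun p => (1 / 2 : ℝ) * ζ p) (Φ ω)))) (R := R)
    ENNReal.ofReal_ne_top (fun ω => by
      rw [← ENNReal.ofReal_mul (shellBelow_nonneg _ _ _), ← ENNReal.ofReal_mul (Real.exp_pos _).le]
      exact ENNReal.ofReal_le_ofReal (shellBelow_mul_exp_neg_wilsonLoc_le_half hC hM hB hε' hext dev S hreg hδ₀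
        hcmp hcG ζ hζ hw (hu ω))) hratio

/-- **The same in the ledgers' real currency** (integrability of the half-coupling density against the rest assumed; `R ≥ 0`
real): `∫ 1[shell](u)·e^{−A(ζ,Φ)}·R dν ≤ (e^{−(w/2)c_G⁻¹((CBM²)⁻¹ε′)²}·C₂₀)·∫ e^{−A(ζ,Φ)}·R dν`. [folklore] -/
theorem integral_shell_wilson_le_of_ratio {outB : Set (PBond P k)} {outP allP : Set (Plaq P k)}
    {C M B η ε' εk δ₀ w : ℝ} (hC : 0 < C) (hM : 0 < M) (hB : 0 < B) (hε' : 0 < ε')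
    (hext : Extension193 (G := G) outB outP allP C M ((C * B * M ^ 2)⁻¹ * ε'))
    (dev : GaugeField P k G → Pl → ℝ) (S : Set Pl)
    (hreg : ∀ (W : GaugeField P k G) (δ : ℝ), 0 < δ → δ ≤ δ₀ → PlaqSmallOn allP δ W →
      ∀ p ∈ S, dev W p < B * δ * η ^ 2)
    (hδ₀ : B⁻¹ * ε' ≤ δ₀) (hcmp : ∀ g : G, dist1 g ^ 2 ≤ cG * (1 - reTr g)) (hcG : 0 < cG)
    (ζ : Plaq P k → ℝ) (hζ : ∀ p, 0 ≤ ζ p) (hw : ∀ p ∈ outP, w ≤ ζ p)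
    (Φ : Ω → GaugeField P k G) (u : Ω → ℝ) {R : Ω → ℝ} (hR : ∀ ω, 0 ≤ R ω)
    (hu : ∀ ω, 2 * ε' * η ^ 2 ≤ u ω →
      ¬ Chi175 (fun (e : {W : GaugeField P k G // ∀ b ∈ outB, W b = Φ ω b}) (p : Pl) => dev e.1 p) S ε' η)
    (hint : Integrable (fun ω => Real.exp (-wilsonLoc (fun p => (1 / 2 : ℝ) * ζ p) (Φ ω)) * R ω) ν) {C₂₀ : ℝ}
    (hratio : ∫ ω, Real.exp (-wilsonLoc (fun p => (1 / 2 : ℝ) * ζ p) (Φ ω)) * R ω ∂ν ≤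
      C₂₀ * ∫ ω, Real.exp (-wilsonLoc ζ (Φ ω)) * R ω ∂ν) :
    ∫ ω, shellBelow (u ω) (2 * εk * η ^ 2) (2 * (εk - ε') * η ^ 2) * Real.exp (-wilsonLoc ζ (Φ ω)) * R ω ∂ν ≤
      (Real.exp (-(w / 2 * (cG⁻¹ * ((C * B * M ^ 2)⁻¹ * ε') ^ 2))) * C₂₀) *
        ∫ ω, Real.exp (-wilsonLoc ζ (Φ ω)) * R ω ∂ν :=
  integral_shell_le_of_pointwise_of_ratio ν (s := fun ω => shellBelow (u ω) (2 * εk * η ^ 2) (2 * (εk - ε') * η ^ 2))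
    (w := fun ω => Real.exp (-wilsonLoc ζ (Φ ω)))
    (w' := fun ω => Real.exp (-wilsonLoc (fun p => (1 / 2 : ℝ) * ζ p) (Φ ω)))
    (fun _ => shellBelow_nonneg _ _ _) (fun _ => (Real.exp_pos _).le) hR (Real.exp_pos _).le
    (fun ω => shellBelow_mul_exp_neg_wilsonLoc_le_half hC hM hB hε' hext dev S hreg hδ₀ hcmp hcG ζ hζ hw (hu ω))
    hint hratio

end Integrated

end Summit.QuantumFields.YangMills.Theorems

end
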